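import Mathlib
import HarnessLib
import HarnessLib.Audit
import Summits.CriticalPhenomena.Statement
import Literature.Probability.RandomPlanarGeometry.SAWParafermion
import Literature.Probability.RandomPlanarGeometry.SLEUniquenessInLaw
import Literature.Probability.RandomPlanarGeometry.SAWCount
import HarnessLib.Audit.Status.Attr

/-!
Route: SAWTwistedSelfEnergy

DORMANT since 2026-08-26T05:02:50Z (reconciler: no traction for 8.4 d (last activity item-evidence-added at 2026-08-17T19:24:59Z); parked, not closed — `ledger route dormant route-CriticalPhenomena-SAWTwistedSelfEnergy --off` to reactiv) — unstaffed, not closed; items shared with open routes are served there. `ledger route dormant <id> --off` reactivates.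

# Route SAWTwistedSelfEnergy — the Z2 parafermion's missing half of Cauchy-Riemann is the tail of
one twisted lace self-energy

It suffices to show X = (K) ∧ (O) ∧ (I) ∧ (T). (K) TWISTED KERNEL: the spin-5/8 twisted
non-backtracking two-point MATRIX of the
plain ℤ² self-avoiding walk, G_n(z)(ι,κ) = Σ over n-step SAWs 0 → z with fictitious incoming step ι
and last step κ of
e^(−i(5/8)·total turning), has a SELF-ENERGY K_n(z) ∈ ℂ^(4×4) defined by the square resolvent
recursion G_n = T·G_(n−1) + Σ_m K_m ⋆ G_(n−m)
(no lace vocabulary needed: the recursion determines K uniquely), and at x_c = 1/μ(ℤ²): K is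
absolutely summable (TwistedKernelSummable),
its absolute moments have abscissa exactly 3/4, i.e. an |x|^(−11/4) tail (TwistedKernelTailIndex),
and criticality is the gap equation
x_c(1 + 2cos 3π/16) + K̂^(1)(0) = 1 in the spin sector (TwistedGapEquation); with the crux filed
informally at open (ChiralTail, informal:
the tail's angular profile is a pure spin harmonic) and the typed glue crux DomainTransfer
(restriction + boundary rows) this gives the robust DCS Conjecture 2
on ℤ² (target ObservableLimitFlat, shared with SAWAsymptoticMorera). (I) SubseqIdentification
(shared r3, martingale principle) and
(T) EventualTight (shared crux) then decide the conjunct by the landed Prokhorov glue. Realises card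
twisted-self-energy-half-cr (spine).
Lean: `TwistedKernelSummable ∧ TwistedKernelTailIndex ∧ TwistedGapEquation ∧ SubseqIdentification ∧
EventualTight`

## Assembly
Crux-only deciding theorem: `closes : TwistedKernelSummable → TwistedKernelTailIndex →
TwistedGapEquation → DomainTransfer → SubseqIdentification →
EventualTight → _root_.SAWScalingLimit`, proved in glue.lean SELF-CONTAINED over fact-free
Literature vocabulary (route-repair 2026-08-16: the route
file no longer imports another route's Theorems/Theses modules; imports = SAWParafermion,
SLEUniquenessInLaw, SAWCount): for each (D, a, b) with
IsEndpointApprox the critical SAW laws are eventually probability measures (a_δ, b_δ joined ⇒ weight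
≥ x_c^n > 0 by SAW.Zd.connectiveConstant_pos;
Ω_δ finite by meshDomain_finite ⇒ finite weight), EventualTight gives IsTightAlongMesh,
SubseqIdentification identifies every subsequential limit
law as chordal SLE_(8/3), and the PROVED criterion convergesInLawToSLE_of_isTightAlongMesh'
(Prokhorov + subsequence principle + uniqueness of the
SLE law, SLEUniquenessInLaw.lean), run on a surrogate family of probability laws on CurveClass ℂ
that agrees with the pushed SAW laws for all small δ
and transferred back along 𝓝[>]0, gives ConvergesInLawToSLE (8/3). The kernel cruxes and
DomainTransfer are the engine for the target
ObservableLimitFlat (and through the martingale principle for SubseqIdentification) and enter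
`closes` as binders. The Assembly item below is the
same chain as a Prop (provable now by the same argument) and is NOT a hypothesis of `closes`;
needs-fact: none.

Rationale: WHY THIS LINE. Every observable route on ℤ² must supply "the other half of Cauchy–Riemann" for the
uniform walk, and the barrier
`not_hasExactVertexRelationZ2` (NienhuisWeightsExcludeVertexSAW) says no finite local stencil
exists; SAWAsymptoticMorera bets on a LOCAL
closure of the vertex defect (Z2VertexIdentity + asymptotic Morera). This line lace-expands the
OBSERVABLE instead of the probability
(Slade 2006 §3.2: the inclusion–exclusion algebra is blind to the weight; Fitzner–van der Hofstad
arXiv:1506.07969: matrix-valued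
non-backtracking expansion in exactly these direction labels): the whole-plane twisted two-point
matrix solves a SQUARE non-local system
(I − x T_σ − K∗)G = E, so all lattice data are analytic (trigonometric M_free, gap equation) and the
conformal content — anomalous spin
dimension 5/4 and chirality — sits in the small-k non-analytic part of K̂, i.e. in one |x|^(−11/4)
tail of one kernel; nothing local on
ℤ² is asked to vanish. Imported area: lace-expansion / self-energy (high-dimensional statistical
mechanics) with complex memory weights,
Tauberian bookkeeping for matrix symbols; downstream the existing martingale-observable machinery
(LSW03 Prop. 5.2, KemppainenSmirnov2017).
New relative to every open route: no route has a self-energy or any non-local exact resolvent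
object; the cheapest falsifier was RUN here
(recursion sanity, ℓ¹ trend, sector gap equation — § Cheapest falsifier).

RANKED CRUXES. #0 ObservableLimitFlat (target) — robust DCS Conjecture 2 on δℤ² with flat
normalisation at b (shared target of route SAWAsymptoticMorera, stmt-CriticalPhenomena-6855): the
boundary-normalised mid-edge parafermion tends to C·(φ′(z₀)/c)^(5/8) with one real lattice constant
C ≠ 0. (why it might fail: open even on Hex (DCS Conj. 2); Kennedy–Lawler lattice effects may make C
depend on more than the flat environment at b; stmt-CriticalPhenomena-5420 (constant-free hex form)
is refuted.) [DuminilCopinSmirnov2012, Smirnov2010ICM, KennedyLawler2013, arXiv:1109.3091]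
#2 TwistedKernelSummable (crux) — card K1 made convention-free: for the spin-5/8 twisted two-point
matrices G_n of the ℤ² SAW (fictitious incoming step ι, last step κ, weight e^(−i(5/8)W), W = total
turning incl. the fictitious turn, first-step reversal excluded) the kernel K uniquely determined by
G_n = T·G_(n−1) + Σ_(m=1..n) K_m ⋆ G_(n−m) (K_m supported in the box of radius m) satisfies Σ_(n,z)
x_c^n ‖K_n(z)‖ < ∞: the twisted self-energy exists at criticality as an ℓ¹ kernel with absolute
convergence in the length. [difficulty: open-problem] (why it might fail: no small parameter in d =
2: exact enumeration to n = 14 (this seat) gives x_c^n‖K_n‖_ℓ¹ = 0.136, 0.121, 0.103, 0.090, 0.080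
(even n = 6..14), effective decay exponent 0.77 < 1 and rising (0.40 at n = 6); summability needs it
to exceed 1 (theory: 25/16 if the tail is |x|^(−11/4)).) [doi:10.1007/b128444, arXiv:1506.07969,
DuminilCopinSmirnov2012,
Summits/CriticalPhenomena/SAWScalingLimit/Ideas/twisted-self-energy-half-cr.md]
#3 TwistedKernelTailIndex (crux) — card K1 tail, log-free form: the n-resolved absolute moments
Σ_(n,z) x_c^n |z|^s ‖K_n(z)‖ are finite for 0 ≤ s < 3/4 and infinite for s > 3/4 — the kernel is ℓ¹
without first moment, tail index 11/4 = 4 − 2σ, the degree-3/4 non-analyticity of K̂ at k = 0 that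
carries the anomalous decay |G(z)| ≍ |z|^(−5/4) instead of the free twisted walk's |z|^(−1). [deps:
TwistedKernelSummable] [difficulty: open-problem] (why it might fail: if TwistedKernelSummable fails
the first clause is void; if winding decoherence around BOTH endpoints shifts the whole-plane decay
away from 2σ = 5/4 the abscissa is not 3/4; sign oscillation in n at fixed z could make n-resolved
moments diverge earlier than the kernel's.) [arXiv:1506.07969, doi:10.1007/b128444,
DuminilCopinSmirnov2012, arXiv:1203.2959]
#4 TwistedGapEquation (crux) — criticality of the ℤ² SAW is the gap equation of the twisted
resolvent in the spin sector: the partial sums Σ_(n≤N) x_c^n Σ_z Σ_k K_n(z)(E,k) i^k converge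
(conditionally) to 1 − x_c(1 + 2cos(3π/16)) — i.e. μ(ℤ²) = (1 + 2cos 3π/16)/(1 − K̂^(1)_(x_c)(0)),
the ℤ² once-visit imbalance 1 − x_c λ₁ = −0.0094 of the card absorbed by the self-energy. [deps:
TwistedKernelSummable] [difficulty: L] (why it might fail: needs conditional convergence of an
alternating-looking series AT x_c plus Abel = ordinary summation; numerics here: x_cλ₁ + partial sum
= 1.031, 1.019, 1.014, 1.010, 1.008, 1.0064 (even N ≤ 14) but odd N hover at 1.001; sector 0 creeps
to 0.93 (a second critical sector?).) [doi:10.1007/b128444, arXiv:1110.1141,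
DuminilCopinSmirnov2012,
Summits/CriticalPhenomena/SAWScalingLimit/Ideas/twisted-self-energy-half-cr.md]
#5 SubseqIdentification (crux) — identification of subsequential limits (shared r3 of
SAWAsymptoticMorera / SAWLeftRightFKG / SAWRenewalTightness, stmt-CriticalPhenomena-0783): every
subsequential weak limit of the critical SAW laws along an endpoint approximation is the chordal
SLE_(8/3) law; obtained from the observable limit by the martingale principle (LSW03 Prop. 5.2) once
it holds uniformly over slit domains. [difficulty: open-problem] (why it might fail: the observable
limit is needed UNIFORMLY over rough slit domains Ω∖γ[0,t] and for all IsEndpointApprox (interior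
mesoscopic starts), plus KS Loewner regularity; no SAW crossing technology exists (KS17 §4).)
[LawlerSchrammWerner2004SAW, LawlerSchrammWerner2003Restriction, KemppainenSmirnov2017,
DuminilCopinSmirnov2012]
#6 DomainTransfer (crux) — glue with content (card K2 + K3): the kernel cruxes, together with CHIRAL
PURITY of the tail (the degree-3/4 homogeneous part of K̂ at 0 is a pure spin harmonic — filed
informally at open as ChiralTail, to be typed once the winding-sector form of the whole-plane
twisted function is fixed) and the boundary rows of M = I − x_cT̂ − K̂ on ℤ² (restriction makes the
Dobrushin-domain observable a sub-sum obeying the same resolvent identity with chains inside Ω),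
give the flat-normalised ℤ² observable limit: multiscale asymptotics of M ⇒ ∂̄f = 0 off the root,
exact boundary argument arg F = −(5/8)·normal ⇒ f = λ(φ′)^(5/8). Typed as the implication from the
three kernel cruxes to the target. [deps: TwistedKernelSummable, TwistedKernelTailIndex,
TwistedGapEquation] [difficulty: open-problem] (why it might fail: as typed it omits ChiralTail: D4
alone permits cos 4θ admixtures at leading order of a NON-analytic symbol (Beffara), so the kernel
cruxes alone need not give a covariant tail; the ℤ² boundary rows of M are not the honeycomb's and a
boundary layer of K-range could spoil the Riemann–Hilbert data.) [DuminilCopinSmirnov2012,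
arXiv:1009.6077, Beffara2008Universal,
Literature.Barriers.CriticalPhenomena.EmbeddingModulusUniqueness, arXiv:1506.07969]
#7 EventualTight (crux) — eventual tightness of the critical SAW laws along every endpoint
approximation (shared stmt-CriticalPhenomena-1881, the repaired form of the refuted all-δ Tight
stmt-CriticalPhenomena-0772; the main crux of SAWRenewalTightness / SAWLeftRightFKG, wanted here as
the precompactness input of `closes`). [difficulty: open-problem] (why it might fail: no
annulus-crossing / RSW technology for the critical SAW (KS17 §4 verifies Condition G2 only for FK,
percolation, harmonic explorer, LERW); even the eventual form has no engine beyond sub-ballisticity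
and the renewal/FKG lines.) [KemppainenSmirnov2017,
Summit.CriticalPhenomena.SAWScalingLimit.Theorems.SAWParafermionTight_refuted, arXiv:1212.6215,
DuminilCopinHammond2013]
#9 TwistedKernelLowOrder (support) — sanity lemma fixing the conventions (provable by finite
enumeration): the recursion-defined kernel vanishes for n ≤ 3 (non-backtracking reference walk: Π_1
= Π_2 = Π_3 = 0), K_4 is supported at the origin, and trace K_4(0) = 4√2 (eight unit squares, total
twisted turning ±2π ↦ −8cos(5π/4)); matches this seat's enumeration to 1e−12. [difficulty:
provable-now] [arXiv:1506.07969, doi:10.1007/b128444]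

TWO-LAYER PLAN. Foreseen glued splits (not filed now): ObservableLimitFlat ⇐ ChiralTail →
DomainTransfer → ObservableLimitFlat, where ChiralTail (informal at
open: the degree-3/4 homogeneous part of K̂ at 0 is a pure spin harmonic, no D4-allowed
angular-momentum-±4 admixture) and DomainTransfer
(restriction makes the Dobrushin-domain observable a sub-sum obeying the same resolvent identity
with K restricted to chains inside Ω; multiscale
asymptotics of M = I − x_cT̂ − K̂ give ∂̄f = 0 off the root and the exact boundary argument arg F =
−(5/8)·normal gives f = λ(φ′)^(5/8)); and
TwistedKernelSummable ⇐ (lace identity: K_n = signed sum over twisted lace graphs) → (N-loop bounds)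
→ TwistedKernelSummable.

KILL CRITERIA. A proof that Σ_(n,z) x_c^n‖K_n(z)‖ = ∞ (TwistedKernelSummable refuted) closes the
route outright (no ℓ¹ kernel, no tail analysis: close
--reason refuted:TwistedKernelSummable); TwistedGapEquation refuted by a convergent-to-another-value
certificate forces a convention audit
(restate), by divergence it kills K1's zero-momentum shadow and the route; ObservableLimitFlat
refuted kills every ℤ² observable route including
this one; SubseqIdentification refuted ⇒ pivot the identification to the restriction routes (the
kernel cruxes survive as a ℤ² covariance engine).
Mooted if SAWAsymptoticMorera's BoundaryIdentification chain proves ObservableLimitFlat first.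

NOT DECOMPOSED YET. ChiralTail and DomainTransfer are filed as informal cruxes right after open
(their faithful typing needs the winding-sector bookkeeping of the
whole-plane twisted function and the boundary rows of M on ℤ², a definition-level task: § Definition
requests); the lace-graph formula for K_n
is a definition request, not an item; constants (the tail profile, the lattice constant C) and the
second possibly-critical sector (spin 0)
are layer-2 questions.

CHEAPEST FALSIFIER. RUN this session (folder exp/twisted_pi.py, exp/gap_check.py; exact enumeration
of ℤ² SAWs to n = 14, pure python, < 2 s): (i) the
recursion-defined kernel has K_1 = K_2 = K_3 = 0, K_4 supported at 0 with trace 4√2 = 5.65685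
(conventions consistent; TwistedKernelLowOrder);
(ii) x_c^n‖K_n‖_ℓ¹ = 0.088, 0.168, 0.136, 0.146, 0.121, 0.123, 0.103, 0.106, 0.090, 0.092, 0.080 (n
= 4..14): decreasing, effective exponent
0.77 at n = 14 and rising — summability UNDECIDED at this size (untwisted σ = 0 comparison: 0.208 →
0.167, exponent ≈ 0.45: the twist helps);
(iii) gap equation: spin-sector eigenvalue of x_cT̂(0) + Σ_(n≤N) x_c^n K̂_n(0) = 1.0308, 1.0014,
1.0187, 1.0002, 1.0136, 1.0008, 1.0101, 1.0012,
1.0079, 1.0014, 1.0064 (N = 4..14), consistent with → 1; sector 0: 0.886 → 0.931 creeping (watch).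
Next cheapest: push (ii) to n ≈ 24 by
transfer-matrix enumeration on kit (one batched job) — an effective exponent settling below 1
retires TwistedKernelSummable in practice.

NUMBERS. x_c(ℤ²) = 1/μ = 0.379052277753, μ = 2.63815853032790(3) (Jensen); σ = 5/8; free twisted
spin-sector eigenvalue λ₁ = 1 + 2cos(3π/16) = 2.66294,
x_cλ₁ = 1.00940 (once-visit imbalance −0.0094, card); spin-0 sector λ₀ = 1 + 2cos(5π/16) = 2.11114;
predicted tail 4 − 2σ = 11/4, moment abscissa
2 − 2σ = 3/4, anomalous decay 2σ = 5/4 (DuminilCopinSmirnov2012 Conj. 2; card §C2); trace K_4(0) =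
4√2.

DEFINITION REQUESTS. After open: (D1) `twistedLaceCoefficient σ n z : Matrix (Fin 4) (Fin 4) ℂ` —
the signed sum over lace graphs of the twisted non-backtracking
memory walk (topic Literature/Probability/RandomPlanarGeometry, next to SAWParafermion.lean; extends
the untwisted `SAWLace.IsDiag`/`piN` of
LaceExpansionSAWIdentity by direction labels and complex turn weights), for the support lemma
"recursion-defined K = lace sum" (--for
TwistedKernelSummable); (D2) informal cruxes ChiralTail (rank 6) and DomainTransfer (rank 7:
TwistedKernelSummable ∧ TwistedKernelTailIndex ∧
ChiralTail → ObservableLimitFlat) via `ledger workitem add --informal`, signatures to be set once D1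
and the winding-sector form are fixed.

Novelty: Searches (2026-08-16): `lit galaxy search --star all` for "twisted lace expansion" (0/0/0), "lace
expansion for the parafermionic" (0/0/0),
"parafermionic self-energy" (0/0/0), "twisted self-energy" (0/0/0), "lace expansion parafermionic
observable" (0), "lace expansion complex weights
self-avoiding walk two dimensions" (0); `lit search --hybrid "lace expansion non-backtracking
matrix-valued two-point function" --source local`
(8: Slade 2006, Heydenreich–van der Hofstad 2017, Fitzner NoBLE thesis 1506.07969, Madras–Slade 1993
— all real positive weights, high d);
`lit frontier CriticalPhenomena --since 2023` (30 rows: lace/deconvolution papers 2310.07640,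
2411.16058, DC–Panis 2410.03649 — none twisted/2D);
`lit search "self-avoiding walk" --source s2 --year-from 2024` (25 rows, none on observables); `lean
search twistedPi|SAWLace --decl` (no twisted
lace object in tree); all 59 open route files' levers tabulated (NOTES.md): none has a self-energy /
non-local resolvent object; card index: the
spine card is graded new-mechanism by the mechanism critic (2026-08-16) against ~120 half-CR /
Nienhuis-barrier cards.
Nearest prior art found: arXiv:1506.07969 (Fitzner–van der Hofstad NoBLE: matrix-valued
non-backtracking lace expansion, real weights, d ≫ 4);
doi:10.1007/b128444 (Slade 2006 §3.2: algebra for general interaction); arXiv:1007.0575 §4 (DCS: the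
curl remark, Conjecture 2); arXiv:1110.1141
(Beaton–Guttmann–Jensen: integrated ℤ² identity vanishes only asymptotically at x_c);  [refs: 10.1007/b128444, 1506.07969, 1007.0575, 1110.1141, doi:10.1007/b128444]

Barriers (technique_class: twisted-lace-expansion, self-energy-chirality): - technique_class: twisted-lace-expansion, self-energy-chirality, martingale-observable
- Literature.Barriers.CriticalPhenomena.ParafermionicHalfCauchyRiemann: evaded — the barrier kills
attempts to DETERMINE F from the ≈2E/3 local vertex relations; the resolvent system (I − xT_σ − K∗)G
= E is square (one equation per unknown) and non-local, and nothing local is required to vanish on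
ℤ²; the conformal content is a tail property (TwistedKernelTailIndex, ChiralTail).
- Literature.Barriers.CriticalPhenomena.NienhuisWeightsExcludeVertexSAW: consistent — no finite
stencil for the uniform walk is claimed (`not_hasExactVertexRelationZ2` respected); the integrable
lattices are recognised as those where the dz-row of K vanishes, the uniform ℤ² walk keeps its
weights.
- Literature.Barriers.CriticalPhenomena.LaceExpansionMeanField: it does not give a small parameter
and none is claimed; the bet is that the spin-5/8 phases make the length series absolutely summable
at x_c (TwistedKernelSummable, effective exponent 0.77 at n = 14 and rising) while the self-energy
DOMINATES the free part at small k (non-mean-field: no first moment), so no bubble condition or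
mean-field output appears.
- Literature.Barriers.CriticalPhenomena.EmbeddingModulusUniqueness: not evaded for free — ChiralTail
states openly that D4 does not upgrade a non-analytic symbol (it does for analytic, free-fermion
ones); the bet is irrelevance of the spin-4 lattice operator, a rotation statement about one tail
constant, file

History (route lifecycle, newest last):
- 2026-08-16T23:44:37Z · rev 1: dropped stmt-CriticalPhenomena-17886 — drop junk duplicate ChiralTail item stmt-17886 (informal 'x', created by an accidental re-run of `workitem add`); the real informal crux ChiralTail is stmt-Crit (planner-plan-novel-CriticalPhenomena-SAWScaling-8a38611a-v2-)
- 2026-08-26T05:02:50Z · DORMANT — reconciler: no traction for 8.4 d (last activity item-evidence-added at 2026-08-17T19:24:59Z); parked, not closed — `ledger route dormant route-CriticalPhenomen (operator:999:1822989)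

sub-problem: SAWScalingLimit · status: dormant · opened planner-plan-novel-CriticalPhenomena-SAWScaling-8a38611a-v2-g12-0 2026-08-16T23:42:33Z · rev 2 · ledger route-CriticalPhenomena-SAWTwistedSelfEnergy
GENERATED by the gate from the ledger (D-0016/17). Provers cite these decls: `theorem foo : Summit.CriticalPhenomena.SAWScalingLimit.Theses.SAWTwistedSelfEnergy.<Decl> := …` in Summits/CriticalPhenomena/SAWScalingLimit/Theorems/<Name>.lean.
-/

namespace Summit.CriticalPhenomena.SAWScalingLimit.Theses.SAWTwistedSelfEnergy

open scoped BigOperators Topology Manifold Classical MeasureTheory ProbabilityTheory Matrix InnerProductSpace ComplexConjugate ContinuousMap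
open Filter Set Function TopologicalSpace MeasureTheory

attribute [summit_statement] _root_.SAWScalingLimit

/-- item stmt-CriticalPhenomena-6855 · target · rank 0 · open · by planner
why it might fail: open even on Hex (DCS Conj. 2); Kennedy–Lawler lattice effects may make C depend on more than the flat environment at b; stmt-CriticalPhenomena-5420 (constant-free hex form) is refuted.
sources: DuminilCopinSmirnov2012, Smirnov2010ICM, KennedyLawler2013, arXiv:1109.3091
[target] robust DCS Conjecture 2 on δℤ²: there is a real lattice constant C ≠ 0 (real by reflection
symmetry; sign not claimed) such that for every Dobrushin domain whose boundary is a horizontal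
segment near b (domain above), every boundary root a_δ → a with outside neighbour a′_δ (reference
direction), b_δ → b on the bottom row, interior edge (z_δ, w_δ) → z₀ and conformal φ : Ω → ℍ with a
↦ ∞, b ↦ 0, φ′ → c ≠ 0 at b, the boundary-normalised mid-edge observable
(F_δ(z_δ,w_δ)+F_δ(w_δ,z_δ))/F_δ(b_δ, b_δ − (0,1)) tends to C·(φ′(z₀)/c)^(5/8) (branch continuous
from b). -/
@[route_item "route-CriticalPhenomena-SAWTwistedSelfEnergy"]
def ObservableLimitFlat : Prop :=
  ∃ C : ℝ, C ≠ 0 ∧ ∀ (D : Literature.Probability.RandomPlanarGeometry.DobrushinDomain) (a a' b z w : ℝ → Literature.Probability.LatticeModels.Site 2) (z₀ : ℂ) (r : ℝ) (Φ : Literature.Probability.RandomPlanarGeometry.ConformalEquiv D.carrier UpperHalfPlane.upperHalfPlaneSet) (L : ℂ → ℂ) (c : ℂ), let H : ℝ → Literature.Probability.LatticeModels.Site 2 → Literature.Probability.LatticeModels.Site 2 → ℂ := fun δ p q => ∑' γ : Literature.Probability.RandomPlanarGeometry.SAW.DomainSAW D.carrier δ (a δ) p, if s(p, q) ∈ γ.walk.edges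 then 0 else Complex.exp (-Complex.I * (5 / 8 : ℂ) * (Literature.Probability.LatticeModels.winding (Literature.Probability.LatticeModels.meshPoint δ (a' δ) :: (γ.walk.support.map (Literature.Probability.LatticeModels.meshPoint δ)) ++ [Literature.Probability.LatticeModels.medialPoint δ s(p, q)]) : ℝ)) * (Literature.Probability.RandomPlanarGeometry.SAW.criticalFugacity : ℂ) ^ (γ.length + 1); (∀ᶠ δ in nhdsWithin 0 (Set.Ioi 0), a δ ∈ Literature.Probability.LatticeModels.meshDomain D.carrier δ ∧ (Literature.Probability.LatticeModels.zdGraph 2).Adj (a δ) (a' δ) ∧ Literature.Probability.LatticeModels.meshPoint δ (a' δ) ∉ D.carrier ∧ b δ ∈ Literature.Probability.LatticeModels.meshDomain D.carrier δ ∧ Literature.Probability.LatticeModels.meshPoint δ (b δ + ![0, -1]) ∉ D.carrier ∧ (Literature.Probability.LatticeModels.discreteDomainGraph D.carrier δ).Adj (z δ) (w δ)) → Filter.Tendsto (fun δ => Literature.Probability.LatticeModels.meshPoint δ (a δ)) (nhdsWithin 0 (Set.Ioi 0)) (nhds (D.pt 0)) → Filter.Tendsto (fun δ => Literature.Probability.LatticeModels.meshPoint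 δ (b δ)) (nhdsWithin 0 (Set.Ioi 0)) (nhds (D.pt 1)) → 0 < r → Metric.ball (D.pt 1) r ∩ D.carrier = Metric.ball (D.pt 1) r ∩ {ζ | (D.pt 1).im < ζ.im} → z₀ ∈ D.carrier → Filter.Tendsto (fun δ => Literature.Probability.LatticeModels.meshPoint δ (z δ)) (nhdsWithin 0 (Set.Ioi 0)) (nhds z₀) → Filter.Tendsto (fun x => ‖Φ x‖) (nhdsWithin (D.pt 0) D.carrier) Filter.atTop → Φ.HasBoundaryValue (D.pt 1) 0 → c ≠ 0 → Filter.Tendsto (deriv Φ) (nhdsWithin (D.pt 1) D.carrier) (nhds c) → ContinuousOn L D.carrier → (∀ x ∈ D.carrier, Complex.exp (L x) = deriv Φ x / c) → Filter.Tendsto L (nhdsWithin (D.pt 1) D.carrier) (nhds 0) → Filter.Tendsto (fun δ => (H δ (z δ) (w δ) + H δ (w δ) (z δ)) / H δ (b δ) (b δ + ![0, -1])) (nhdsWithin 0 (Set.Ioi 0)) (nhds ((C : ℂ) * Complex.exp ((5 / 8 : ℂ) * L z₀)))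

/-- item stmt-CriticalPhenomena-17872 · crux · rank 2 · open · by planner
why it might fail: no small parameter in d = 2: exact enumeration to n = 14 (this seat) gives x_c^n‖K_n‖_ℓ¹ = 0.136, 0.121, 0.103, 0.090, 0.080 (even n = 6..14), effective decay exponent 0.77 < 1 and rising (0.40 at n = 6); summability needs it to exceed 1 (theory: 25/16 if the tail is |x|^(−11/4)).
sources: doi:10.1007/b128444, arXiv:1506.07969, DuminilCopinSmirnov2012, Summits/CriticalPhenomena/SAWScalingLimit/Ideas/twisted-self-energy-half-cr.md
[crux] card K1 made convention-free: for the spin-5/8 twisted two-point matrices G_n of the ℤ² SAW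
(fictitious incoming step ι, last step κ, weight e^(−i(5/8)W), W = total turning incl. the
fictitious turn, first-step reversal excluded) the kernel K uniquely determined by G_n = T·G_(n−1) +
Σ_(m=1..n) K_m ⋆ G_(n−m) (K_m supported in the box of radius m) satisfies Σ_(n,z) x_c^n ‖K_n(z)‖ <
∞: the twisted self-energy exists at criticality as an ℓ¹ kernel with absolute convergence in the
length. [difficulty: open-problem] -/
@[route_item "route-CriticalPhenomena-SAWTwistedSelfEnergy", crux]
def TwistedKernelSummable : Prop :=
  let dir : Fin 4 → Literature.Probability.LatticeModels.Site 2 := ![![1, 0], ![0, 1], ![-1, 0], ![0, -1]]; let σ : ℝ := 5 / 8; let T : Matrix (Fin 4) (Fin 4) ℂ := fun a b => if dir b = -dir a then 0 else Complex.exp (-Complex.I * σ * (Literature.Probability.LatticeModels.turning (-Literature.Probability.LatticeModels.Site.toComplex (dir a)) 0 (Literature.Probability.LatticeModels.Site.toComplex (dir b)) : ℝ)); let G : ℕ → Literature.Probability.LatticeModels.Site 2 → Matrix (Fin 4) (Fin 4) ℂ := fun n z ι κ => if n = 0 then (if z = 0 ∧ ι = κ then 1 else 0) else ∑ p ∈ ((Literature.Probability.LatticeModels.zdGraph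 2).finsetWalkLength n (0 : Literature.Probability.LatticeModels.Site 2) z).filter (fun p => p.IsPath), (if p.getVert 1 = -dir ι ∨ z - p.getVert (n - 1) ≠ dir κ then 0 else Complex.exp (-Complex.I * σ * (Literature.Probability.LatticeModels.winding ((-Literature.Probability.LatticeModels.Site.toComplex (dir ι)) :: (p.support.map Literature.Probability.LatticeModels.Site.toComplex)) : ℝ))); let IsTwistedKernel : (ℕ → Literature.Probability.LatticeModels.Site 2 → Matrix (Fin 4) (Fin 4) ℂ) → Prop := fun K => (∀ n z, z ∉ Literature.Probability.LatticeModels.box 2 n → K n z = 0) ∧ (∀ n, 1 ≤ n → ∀ z, G n z = Matrix.of (fun ι κ => ∑ κ' : Fin 4, G (n - 1) (z - dir κ) ι κ' * T κ' κ) + ∑ m ∈ Finset.Icc 1 n, ∑ y ∈ Literature.Probability.LatticeModels.box 2 m, K m y * G (n - m) (z - y)); ∀ K : ℕ → Literature.Probability.LatticeModels.Site 2 → Matrix (Fin 4) (Fin 4) ℂ, IsTwistedKernel K → Summable (fun p : ℕ × Literature.Probability.LatticeModels.Site 2 => Literature.Probability.RandomPlanarGeometry.SAW.criticalFugacity ^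 p.1 * ∑ ι : Fin 4, ∑ κ : Fin 4, ‖K p.1 p.2 ι κ‖)

/-- item stmt-CriticalPhenomena-17873 · crux · rank 3 · open · by planner
why it might fail: if TwistedKernelSummable fails the first clause is void; if winding decoherence around BOTH endpoints shifts the whole-plane decay away from 2σ = 5/4 the abscissa is not 3/4; sign oscillation in n at fixed z could make n-resolved moments diverge earlier than the kernel's.
sources: arXiv:1506.07969, doi:10.1007/b128444, DuminilCopinSmirnov2012, arXiv:1203.2959
[crux] card K1 tail, log-free form: the n-resolved absolute moments Σ_(n,z) x_c^n |z|^s ‖K_n(z)‖ are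
finite for 0 ≤ s < 3/4 and infinite for s > 3/4 — the kernel is ℓ¹ without first moment, tail index
11/4 = 4 − 2σ, the degree-3/4 non-analyticity of K̂ at k = 0 that carries the anomalous decay |G(z)|
≍ |z|^(−5/4) instead of the free twisted walk's |z|^(−1). [deps: TwistedKernelSummable] [difficulty:
open-problem] -/
@[route_item "route-CriticalPhenomena-SAWTwistedSelfEnergy", crux]
def TwistedKernelTailIndex : Prop :=
  let dir : Fin 4 → Literature.Probability.LatticeModels.Site 2 := ![![1, 0], ![0, 1], ![-1, 0], ![0, -1]]; let σ : ℝ := 5 / 8; let T : Matrix (Fin 4) (Fin 4) ℂ := fun a b => if dir b = -dir a then 0 else Complex.exp (-Complex.I * σ * (Literature.Probability.LatticeModels.turning (-Literature.Probability.LatticeModels.Site.toComplex (dir a)) 0 (Literature.Probability.LatticeModels.Site.toComplex (dir b)) : ℝ)); let G : ℕ → Literature.Probability.LatticeModels.Site 2 → Matrix (Fin 4) (Fin 4) ℂ := fun n z ι κ => if n = 0 then (if z = 0 ∧ ι = κ then 1 else 0) else ∑ p ∈ ((Literature.Probability.LatticeModels.zdGraph 2).finsetWalkLength n (0 : Literature.Probability.LatticeModels.Site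 2) z).filter (fun p => p.IsPath), (if p.getVert 1 = -dir ι ∨ z - p.getVert (n - 1) ≠ dir κ then 0 else Complex.exp (-Complex.I * σ * (Literature.Probability.LatticeModels.winding ((-Literature.Probability.LatticeModels.Site.toComplex (dir ι)) :: (p.support.map Literature.Probability.LatticeModels.Site.toComplex)) : ℝ))); let IsTwistedKernel : (ℕ → Literature.Probability.LatticeModels.Site 2 → Matrix (Fin 4) (Fin 4) ℂ) → Prop := fun K => (∀ n z, z ∉ Literature.Probability.LatticeModels.box 2 n → K n z = 0) ∧ (∀ n, 1 ≤ n → ∀ z, G n z = Matrix.of (fun ι κ => ∑ κ' : Fin 4, G (n - 1) (z - dir κ) ι κ' * T κ' κ) + ∑ m ∈ Finset.Icc 1 n, ∑ y ∈ Literature.Probability.LatticeModels.box 2 m, K m y * G (n - m) (z - y)); ∀ K : ℕ → Literature.Probability.LatticeModels.Site 2 → Matrix (Fin 4) (Fin 4) ℂ, IsTwistedKernel K → (∀ s : ℝ, 0 ≤ s → s < 3 / 4 → Summable (fun p : ℕ × Literature.Probability.LatticeModels.Site 2 => Literature.Probability.RandomPlanarGeometry.SAW.criticalFugacity ^ p.1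 * ‖Literature.Probability.LatticeModels.Site.toComplex p.2‖ ^ s * ∑ ι : Fin 4, ∑ κ : Fin 4, ‖K p.1 p.2 ι κ‖)) ∧ (∀ s : ℝ, 3 / 4 < s → ¬ Summable (fun p : ℕ × Literature.Probability.LatticeModels.Site 2 => Literature.Probability.RandomPlanarGeometry.SAW.criticalFugacity ^ p.1 * ‖Literature.Probability.LatticeModels.Site.toComplex p.2‖ ^ s * ∑ ι : Fin 4, ∑ κ : Fin 4, ‖K p.1 p.2 ι κ‖))

/-- item stmt-CriticalPhenomena-17874 · crux · rank 4 · open · by planner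
why it might fail: needs conditional convergence of an alternating-looking series AT x_c plus Abel = ordinary summation; numerics here: x_cλ₁ + partial sum = 1.031, 1.019, 1.014, 1.010, 1.008, 1.0064 (even N ≤ 14) but odd N hover at 1.001; sector 0 creeps to 0.93 (a second critical sector?).
sources: doi:10.1007/b128444, arXiv:1110.1141, DuminilCopinSmirnov2012, Summits/CriticalPhenomena/SAWScalingLimit/Ideas/twisted-self-energy-half-cr.md
[crux] criticality of the ℤ² SAW is the gap equation of the twisted resolvent in the spin sector:
the partial sums Σ_(n≤N) x_c^n Σ_z Σ_k K_n(z)(E,k) i^k converge (conditionally) to 1 − x_c(1 +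
2cos(3π/16)) — i.e. μ(ℤ²) = (1 + 2cos 3π/16)/(1 − K̂^(1)_(x_c)(0)), the ℤ² once-visit imbalance 1 −
x_c λ₁ = −0.0094 of the card absorbed by the self-energy. [deps: TwistedKernelSummable] [difficulty:
L] -/
@[route_item "route-CriticalPhenomena-SAWTwistedSelfEnergy", crux]
def TwistedGapEquation : Prop :=
  let dir : Fin 4 → Literature.Probability.LatticeModels.Site 2 := ![![1, 0], ![0, 1], ![-1, 0], ![0, -1]]; let σ : ℝ := 5 / 8; let T : Matrix (Fin 4) (Fin 4) ℂ := fun a b => if dir b = -dir a then 0 else Complex.exp (-Complex.I * σ * (Literature.Probability.LatticeModels.turning (-Literature.Probability.LatticeModels.Site.toComplex (dir a)) 0 (Literature.Probability.LatticeModels.Site.toComplex (dir b)) : ℝ)); let G : ℕ → Literature.Probability.LatticeModels.Site 2 → Matrix (Fin 4) (Fin 4) ℂ := fun n z ι κ => if n = 0 then (if z = 0 ∧ ι = κ then 1 else 0) else ∑ p ∈ ((Literature.Probability.LatticeModels.zdGraph 2).finsetWalkLength n (0 : Literature.Probability.LatticeModels.Site 2) z).filter (fun p => p.IsPath), (if p.getVert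 1 = -dir ι ∨ z - p.getVert (n - 1) ≠ dir κ then 0 else Complex.exp (-Complex.I * σ * (Literature.Probability.LatticeModels.winding ((-Literature.Probability.LatticeModels.Site.toComplex (dir ι)) :: (p.support.map Literature.Probability.LatticeModels.Site.toComplex)) : ℝ))); let IsTwistedKernel : (ℕ → Literature.Probability.LatticeModels.Site 2 → Matrix (Fin 4) (Fin 4) ℂ) → Prop := fun K => (∀ n z, z ∉ Literature.Probability.LatticeModels.box 2 n → K n z = 0) ∧ (∀ n, 1 ≤ n → ∀ z, G n z = Matrix.of (fun ι κ => ∑ κ' : Fin 4, G (n - 1) (z - dir κ) ι κ' * T κ' κ) + ∑ m ∈ Finset.Icc 1 n, ∑ y ∈ Literature.Probability.LatticeModels.box 2 m, K m y * G (n - m) (z - y)); ∀ K : ℕ → Literature.Probability.LatticeModels.Site 2 → Matrix (Fin 4) (Fin 4) ℂ, IsTwistedKernel K → Filter.Tendsto (fun N : ℕ => ∑ n ∈ Finset.range (N + 1), (Literature.Probability.RandomPlanarGeometry.SAW.criticalFugacity : ℂ) ^ n * ∑ z ∈ Literature.Probability.LatticeModels.box 2 n, ∑ k : Fin 4, K n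 z 0 k * Complex.I ^ (k : ℕ)) Filter.atTop (nhds (1 - (Literature.Probability.RandomPlanarGeometry.SAW.criticalFugacity : ℂ) * ((1 + 2 * Real.cos (3 * Real.pi / 16) : ℝ) : ℂ)))

/-- item stmt-CriticalPhenomena-0783 · crux · rank 5 · open · by planner
why it might fail: the observable limit is needed UNIFORMLY over rough slit domains Ω∖γ[0,t] and for all IsEndpointApprox (interior mesoscopic starts), plus KS Loewner regularity; no SAW crossing technology exists (KS17 §4).
sources: LawlerSchrammWerner2004SAW, LawlerSchrammWerner2003Restriction, KemppainenSmirnov2017, DuminilCopinSmirnov2012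
[crux] r3: identification of subsequential limits — for every Dobrushin domain D, endpoint
approximation (a_δ,b_δ), sequence s_n → 0+ and probability measure μ on CurveClass ℂ, if ∫ f∘curve
d(Literature.Probability.RandomPlanarGeometry.SAW.law D (s n) …) → ∫ f dμ for all bounded continuous
f then μ is the chordal SLE_{8/3} law in D (Literature.Probability.RandomPlanarGeometry.IsSLELaw
(8/3) D μ). Obtained from r2 (observable limit) by the martingale principle (LSW03
arXiv:math/0209343 Prop. 5.2: κ = 8/3 is singled out by the 5/8-observable), or from restriction
(sibling route). -/
@[route_item "route-CriticalPhenomena-SAWTwistedSelfEnergy", crux]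
def SubseqIdentification : Prop :=
  ∀ (D : Literature.Probability.RandomPlanarGeometry.DobrushinDomain) (a b : ℝ → Literature.Probability.LatticeModels.Site 2), Literature.Probability.RandomPlanarGeometry.SAW.IsEndpointApprox D a b → ∀ (s : ℕ → ℝ) (μ : MeasureTheory.Measure (Literature.Probability.RandomPlanarGeometry.CurveClass ℂ)), Filter.Tendsto s Filter.atTop (nhdsWithin 0 (Set.Ioi 0)) → MeasureTheory.IsProbabilityMeasure μ → (∀ f : BoundedContinuousFunction (Literature.Probability.RandomPlanarGeometry.CurveClass ℂ) ℝ, Filter.Tendsto (fun n => ∫ γ, f γ.curve ∂(Literature.Probability.RandomPlanarGeometry.SAW.law D.carrier (s n) (a (s n)) (b (s n)))) Filter.atTop (nhds (∫ x, f x ∂μ))) → Literature.Probability.RandomPlanarGeometry.IsSLELaw ((8 : NNReal) / 3) D μ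

/-- item stmt-CriticalPhenomena-17875 · crux · rank 6 · open · by planner
why it might fail: as typed it omits ChiralTail: D4 alone permits cos 4θ admixtures at leading order of a NON-analytic symbol (Beffara), so the kernel cruxes alone need not give a covariant tail; the ℤ² boundary rows of M are not the honeycomb's and a boundary layer of K-range could spoil the Riemann–Hilbert data.
sources: DuminilCopinSmirnov2012, arXiv:1009.6077, Beffara2008Universal, Literature.Barriers.CriticalPhenomena.EmbeddingModulusUniqueness, arXiv:1506.07969
[crux] glue with content (card K2 + K3): the kernel cruxes, together with CHIRAL PURITY of the tail
(the degree-3/4 homogeneous part of K̂ at 0 is a pure spin harmonic — filed informally at open as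
ChiralTail, to be typed once the winding-sector form of the whole-plane twisted function is fixed)
and the boundary rows of M = I − x_cT̂ − K̂ on ℤ² (restriction makes the Dobrushin-domain observable
a sub-sum obeying the same resolvent identity with chains inside Ω), give the flat-normalised ℤ²
observable limit: multiscale asymptotics of M ⇒ ∂̄f = 0 off the root, exact boundary argument arg F
= −(5/8)·normal ⇒ f = λ(φ′)^(5/8). Typed as the implication from the three kernel cruxes to the
target. [deps: TwistedKernelSummable, TwistedKernelTailIndex, TwistedGapEquation] [difficulty:
open-problem] -/
@[route_item "route-CriticalPhenomena-SAWTwistedSelfEnergy", crux]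
def DomainTransfer : Prop :=
  TwistedKernelSummable → TwistedKernelTailIndex → TwistedGapEquation → ObservableLimitFlat

/-- item stmt-CriticalPhenomena-1881 · crux · rank 7 · open · by planner
why it might fail: no annulus-crossing / RSW technology for the critical SAW (KS17 §4 verifies Condition G2 only for FK, percolation, harmonic explorer, LERW); even the eventual form has no engine beyond sub-ballisticity and the renewal/FKG lines.
sources: KemppainenSmirnov2017, Summit.CriticalPhenomena.SAWScalingLimit.Theorems.SAWParafermionTight_refuted, arXiv:1212.6215, DuminilCopinHammond2013
[support] EVENTUAL TIGHTNESS of the critical SAW laws: for every Dobrushin domain and endpoint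
approximation, IsTightAlongMesh (fun δ γ => γ.curve) (fun δ => SAW.law D δ a_δ b_δ) — for every ε
some compact set of CurveClass ℂ carries all but ε of the mass for all small δ. This is the form the
Prokhorov criterion convergesInLawToSLE_of_isTightAlongMesh consumes and the repair of the refuted
all-δ Tight (IsTightLaws over δ ∈ (0,1]) suggested by the refuting theorem; offered to routes
SAWParafermion / SAWConfRestriction as their restated r3/r4. -/
@[route_item "route-CriticalPhenomena-SAWTwistedSelfEnergy", crux]
def EventualTight : Prop :=
  ∀ (D : Literature.Probability.RandomPlanarGeometry.DobrushinDomain) (a b : ℝ → Literature.Probability.LatticeModels.Site 2), Literature.Probability.RandomPlanarGeometry.SAW.IsEndpointApprox D a b → Literature.Probability.RandomPlanarGeometry.IsTightAlongMesh (fun δ (γ : Literature.Probability.RandomPlanarGeometry.SAW.DomainSAW D.carrier δ (a δ) (b δ)) => γ.curve) (fun δ => Literature.Probability.RandomPlanarGeometry.SAW.law D.carrier δ (a δ) (b δ))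

-- item stmt-CriticalPhenomena-17885 · support · rank 8 · open · by planner — informal only, no Lean statement yet:
--   [crux] CHIRAL PURITY OF THE TAIL (card twisted-self-energy-half-cr K2): for the recursion-defined
--   spin-5/8 twisted self-energy K of TwistedKernelSummable, the leading |x|^(-11/4) tail of K(x)
--   (equivalently the degree-3/4 homogeneous part of its Fourier symbol K^(k) at k=0, in the critical
--   spin sector of TwistedGapEquation) is a PURE spin harmonic: no D4-allowed admixture of relative
--   angular momentum +-4 (cos 4theta) at leading order; i.e. the tail constant matrix is SO(2)-covariant
--   beyond the exact D4 covariance. To be typed once the winding-sector form of the whole-plane twisted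
--   two-point mat

/-- item stmt-CriticalPhenomena-17876 · support · rank 9 · open · by planner
sources: arXiv:1506.07969, doi:10.1007/b128444
[support] sanity lemma fixing the conventions (provable by finite enumeration): the
recursion-defined kernel vanishes for n ≤ 3 (non-backtracking reference walk: Π_1 = Π_2 = Π_3 = 0),
K_4 is supported at the origin, and trace K_4(0) = 4√2 (eight unit squares, total twisted turning
±2π ↦ −8cos(5π/4)); matches this seat's enumeration to 1e−12. [difficulty: provable-now] -/
@[route_item "route-CriticalPhenomena-SAWTwistedSelfEnergy"]
def TwistedKernelLowOrder : Prop :=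
  let dir : Fin 4 → Literature.Probability.LatticeModels.Site 2 := ![![1, 0], ![0, 1], ![-1, 0], ![0, -1]]; let σ : ℝ := 5 / 8; let T : Matrix (Fin 4) (Fin 4) ℂ := fun a b => if dir b = -dir a then 0 else Complex.exp (-Complex.I * σ * (Literature.Probability.LatticeModels.turning (-Literature.Probability.LatticeModels.Site.toComplex (dir a)) 0 (Literature.Probability.LatticeModels.Site.toComplex (dir b)) : ℝ)); let G : ℕ → Literature.Probability.LatticeModels.Site 2 → Matrix (Fin 4) (Fin 4) ℂ := fun n z ι κ => if n = 0 then (if z = 0 ∧ ι = κ then 1 else 0) else ∑ p ∈ ((Literature.Probability.LatticeModels.zdGraph 2).finsetWalkLength n (0 : Literature.Probability.LatticeModels.Site 2) z).filter (fun p => p.IsPath), (if p.getVert 1 = -dir ι ∨ z - p.getVert (n - 1) ≠ dir κ then 0 else Complex.exp (-Complex.I * σ * (Literature.Probability.LatticeModels.winding ((-Literature.Probability.LatticeModels.Site.toComplex (dir ι)) :: (p.support.map Literature.Probability.LatticeModels.Site.toComplex)) : ℝ))); let IsTwistedKernel : (ℕ → Literature.Probability.LatticeModels.Site 2 → Matrix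 (Fin 4) (Fin 4) ℂ) → Prop := fun K => (∀ n z, z ∉ Literature.Probability.LatticeModels.box 2 n → K n z = 0) ∧ (∀ n, 1 ≤ n → ∀ z, G n z = Matrix.of (fun ι κ => ∑ κ' : Fin 4, G (n - 1) (z - dir κ) ι κ' * T κ' κ) + ∑ m ∈ Finset.Icc 1 n, ∑ y ∈ Literature.Probability.LatticeModels.box 2 m, K m y * G (n - m) (z - y)); ∀ K : ℕ → Literature.Probability.LatticeModels.Site 2 → Matrix (Fin 4) (Fin 4) ℂ, IsTwistedKernel K → (∀ n, n ≤ 3 → ∀ z, K n z = 0) ∧ (∀ z, z ≠ 0 → K 4 z = 0) ∧ Matrix.trace (K 4 0) = ((4 * Real.sqrt 2 : ℝ) : ℂ)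

/-- item stmt-CriticalPhenomena-17877 · assembly · rank 1 · open · by planner
sources: KemppainenSmirnov2017, LawlerSchrammWerner2004SAW, Literature.Probability.RandomPlanarGeometry.convergesInLawToSLE_of_isTightAlongMesh
[assembly] TwistedKernelSummable → TwistedKernelTailIndex → TwistedGapEquation → DomainTransfer →
SubseqIdentification → (eventual tightness, inlined) → SAWScalingLimit (provable now). -/
@[route_item "route-CriticalPhenomena-SAWTwistedSelfEnergy"]
def Assembly : Prop :=
  TwistedKernelSummable → TwistedKernelTailIndex → TwistedGapEquation → DomainTransfer → SubseqIdentification → (∀ (D : Literature.Probability.RandomPlanarGeometry.DobrushinDomain) (a b : ℝ → Literature.Probability.LatticeModels.Site 2), Literature.Probability.RandomPlanarGeometry.SAW.IsEndpointApprox D a b → Literature.Probability.RandomPlanarGeometry.IsTightAlongMesh (fun δ (γ : Literature.Probability.RandomPlanarGeometry.SAW.DomainSAW D.carrier δ (a δ) (b δ)) => γ.curve) (fun δ => Literature.Probability.RandomPlanarGeometry.SAW.law D.carrier δ (a δ) (b δ))) → _root_.SAWScalingLimit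

/-! D-0027 §2.1 — DECIDING THEOREM (planner-authored via `route open/edit --closes-file`; by planner-rrepair-CriticalPhenomena-SAWTwistedSe-7e004996-0 2026-08-16T23:53:09Z):
its hypotheses are this route's items and its conclusion the sub-problem Statement (glue_lint), and it elaborates with this file. -/

@[closes "route-CriticalPhenomena-SAWTwistedSelfEnergy"] theorem closes (h₁ : TwistedKernelSummable) (h₂ : TwistedKernelTailIndex) (h₃ : TwistedGapEquation)
    (h₄ : DomainTransfer) (h₅ : SubseqIdentification) (h₆ : EventualTight) : _root_.SAWScalingLimit := by
  intro D a b hab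
  classical
  -- Deciding theorem (D-0027 §2.1), SELF-CONTAINED over Literature (route-repair 2026-08-16: the
  -- route no longer imports another route's Theorems/Theses files): eventual tightness of the pushed
  -- critical SAW laws (h₆) and identification of every subsequential weak limit as the chordal
  -- SLE_{8/3} law (h₅) give `SAWScalingLimit` through the PROVED criterion
  -- `convergesInLawToSLE_of_isTightAlongMesh'` (Prokhorov + subsequence principle + uniqueness of the
  -- SLE law, `SLEUniquenessInLaw.lean`), run on a surrogate family of probability laws on
  -- `CurveClass ℂ` that agrees with the pushed SAW laws for all small `δ` (where the SAW law IS a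
  -- probability measure: `a_δ, b_δ` joined and `Ω_δ` finite) and transferred back along `𝓝[>] 0`.
  -- The kernel cruxes h₁–h₃ and the glue crux h₄ are the engine of the target `ObservableLimitFlat`
  -- (and, through the martingale principle, of h₅) and enter as binders.
  -- (0) the critical fugacity `x_c = 1/μ(ℤ²)` is positive (`μ(ℤ²) ≥ 1`, in tree)
  have hxc : 0 < Literature.Probability.RandomPlanarGeometry.SAW.criticalFugacity := by
    have h := Literature.Probability.RandomPlanarGeometry.SAW.Zd.connectiveConstant_pos 2
    rw [Literature.Probability.RandomPlanarGeometry.SAW.Zd.connectiveConstant_two] at h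
    unfold Literature.Probability.RandomPlanarGeometry.SAW.criticalFugacity
    exact inv_pos.2 h
  -- (1) for all small `δ > 0` the critical SAW law of `Ω_δ` from `a_δ` to `b_δ` is a probability
  -- measure: `a_δ, b_δ` are joined (a SAW exists, positive weight) and `Ω_δ` is finite (finitely
  -- many SAWs, finite total weight)
  have hprob : ∀ᶠ δ in 𝓝[>] (0 : ℝ), IsProbabilityMeasure
      (Literature.Probability.RandomPlanarGeometry.SAW.law D.carrier δ (a δ) (b δ)) := by
    filter_upwards [hab.reachable, self_mem_nhdsWithin] with δ hreach hδpos
    have hδ : (0 : ℝ) < δ := hδpos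
    have hfin : (Literature.Probability.LatticeModels.meshDomain D.carrier δ).Finite :=
      Literature.Probability.LatticeModels.meshDomain_finite D.isBounded hδ
    haveI hLF : (Literature.Probability.LatticeModels.discreteDomainGraph D.carrier δ).LocallyFinite :=
      fun v => (hfin.subset fun w hw =>
        (Literature.Probability.LatticeModels.discreteDomainGraph_adj_iff.1
          ((SimpleGraph.mem_neighborSet _ _ _).1 hw)).2.2).fintype
    -- every vertex of a walk of `Ω_δ` after the first lies in `Ω_δ`
    have hsupp : ∀ {u v : Literature.Probability.LatticeModels.Site 2}
        (p : (Literature.Probability.LatticeModels.discreteDomainGraph D.carrier δ).Walk u v),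
        ∀ w ∈ p.support.tail, w ∈ Literature.Probability.LatticeModels.meshDomain D.carrier δ := by
      intro u v p
      induction p with
      | nil => intro w hw; simp at hw
      | cons h q ih =>
        intro w hw
        rw [SimpleGraph.Walk.support_cons, List.tail_cons, SimpleGraph.Walk.mem_support_iff] at hw
        rcases hw with rfl | hw
        · exact (Literature.Probability.LatticeModels.discreteDomainGraph_adj_iff.1 h).2.2
        · exact ih w hw
    -- hence a self-avoiding walk of `Ω_δ` has at most `|Ω_δ|` steps
    have hlen : ∀ {u v : Literature.Probability.LatticeModels.Site 2}
        (p : (Literature.Probability.LatticeModels.discreteDomainGraph D.carrier δ).Walk u v),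
        p.IsPath → p.length < hfin.toFinset.card + 1 := by
      intro u v p hp
      have hnd : p.support.tail.Nodup := List.Nodup.sublist (List.tail_sublist _) hp.support_nodup
      have h1 : p.support.tail.length = p.length := by
        rw [List.length_tail, SimpleGraph.Walk.length_support]
        rfl
      have h2 : p.support.tail.toFinset ⊆ hfin.toFinset := by
        intro w hw
        rw [Set.Finite.mem_toFinset]
        exact hsupp p w (List.mem_toFinset.1 hw)
      have h3 := Finset.card_le_card h2
      rw [List.toFinset_card_of_nodup hnd, h1] at h3
      omega
    haveI hfinite : Finite
        (Literature.Probability.RandomPlanarGeometry.SAW.DomainSAW D.carrier δ (a δ) (b δ)) := by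
      refine Finite.of_injective
        (β := {p : (Literature.Probability.LatticeModels.discreteDomainGraph D.carrier δ).Walk
          (a δ) (b δ) // p.IsPath ∧ p.length < hfin.toFinset.card + 1})
        (fun γ => ⟨γ.walk, γ.isPath, hlen γ.walk γ.isPath⟩) ?_
      rintro ⟨p, hp⟩ ⟨q, hq⟩ h
      have hpq : p = q := congrArg Subtype.val h
      cases hpq
      rfl
    haveI := Fintype.ofFinite
      (Literature.Probability.RandomPlanarGeometry.SAW.DomainSAW D.carrier δ (a δ) (b δ))
    -- total weight: finite …
    have huniv : Literature.Probability.RandomPlanarGeometry.SAW.weight D.carrier δ (a δ) (b δ)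
        Set.univ = ∑' γ : Literature.Probability.RandomPlanarGeometry.SAW.DomainSAW D.carrier δ
          (a δ) (b δ), ENNReal.ofReal
            (Literature.Probability.RandomPlanarGeometry.SAW.criticalFugacity ^ γ.length) := by
      rw [Literature.Probability.RandomPlanarGeometry.SAW.weight,
        MeasureTheory.Measure.sum_apply _ MeasurableSet.univ]
      simp
    have htop : Literature.Probability.RandomPlanarGeometry.SAW.weight D.carrier δ (a δ) (b δ)
        Set.univ ≠ ⊤ := by
      rw [huniv, tsum_fintype]
      exact ENNReal.sum_ne_top.2 fun _ _ => ENNReal.ofReal_ne_top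
    -- … and positive
    have h0 : Literature.Probability.RandomPlanarGeometry.SAW.weight D.carrier δ (a δ) (b δ)
        Set.univ ≠ 0 := by
      obtain ⟨p⟩ := hreach
      let γ₀ : Literature.Probability.RandomPlanarGeometry.SAW.DomainSAW D.carrier δ (a δ) (b δ) :=
        ⟨p.bypass, p.bypass_isPath⟩
      have h1 : Literature.Probability.RandomPlanarGeometry.SAW.weight D.carrier δ (a δ) (b δ) {γ₀}
          ≤ Literature.Probability.RandomPlanarGeometry.SAW.weight D.carrier δ (a δ) (b δ)
            Set.univ := measure_mono (Set.subset_univ _)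
      rw [Literature.Probability.RandomPlanarGeometry.SAW.weight_singleton] at h1
      have h2 : 0 < ENNReal.ofReal
          (Literature.Probability.RandomPlanarGeometry.SAW.criticalFugacity ^ γ₀.length) :=
        ENNReal.ofReal_pos.2 (pow_pos hxc _)
      exact (h2.trans_le h1).ne'
    constructor
    rw [Literature.Probability.RandomPlanarGeometry.SAW.law, Measure.smul_apply, smul_eq_mul,
      ENNReal.inv_mul_cancel h0 htop]
  -- (2) surrogate family of probability laws on the curve space, equal to the pushed SAW laws
  -- for all small `δ`
  obtain ⟨ν, hν⟩ : ∃ ν : ℝ → Measure (Literature.Probability.RandomPlanarGeometry.CurveClass ℂ),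
      ∀ δ, ν δ = if IsProbabilityMeasure
          (Literature.Probability.RandomPlanarGeometry.SAW.law D.carrier δ (a δ) (b δ)) then
        (Literature.Probability.RandomPlanarGeometry.SAW.law D.carrier δ (a δ) (b δ)).map
          (fun γ => γ.curve)
        else Measure.dirac (Literature.Probability.RandomPlanarGeometry.CurveClass.mk
          (Literature.Probability.RandomPlanarGeometry.Curve.const 0)) :=
    ⟨_, fun _ => rfl⟩
  have hν_of : ∀ δ, IsProbabilityMeasure
      (Literature.Probability.RandomPlanarGeometry.SAW.law D.carrier δ (a δ) (b δ)) →
      ν δ = (Literature.Probability.RandomPlanarGeometry.SAW.law D.carrier δ (a δ) (b δ)).map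
        (fun γ => γ.curve) := fun δ h => by rw [hν δ, if_pos h]
  have hνprob : ∀ δ, IsProbabilityMeasure (ν δ) := by
    intro δ
    by_cases h : IsProbabilityMeasure
        (Literature.Probability.RandomPlanarGeometry.SAW.law D.carrier δ (a δ) (b δ))
    · rw [hν_of δ h]
      exact Measure.isProbabilityMeasure_map
        (Literature.Probability.RandomPlanarGeometry.SAW.aemeasurable_curve _ _ _ _)
    · rw [hν δ, if_neg h]
      infer_instance
  have hev : ∀ᶠ δ in 𝓝[>] (0 : ℝ),
      ν δ = (Literature.Probability.RandomPlanarGeometry.SAW.law D.carrier δ (a δ) (b δ)).map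
        (fun γ => γ.curve) := hprob.mono hν_of
  -- (3) the convergence criterion (Prokhorov + subsequence principle + uniqueness of the SLE law,
  -- all proved in tree) applied to the surrogate family, observed through the identity
  have key : Literature.Probability.RandomPlanarGeometry.ConvergesInLawToSLE ((8 : NNReal) / 3) D
      (Ωδ := fun _ : ℝ => Literature.Probability.RandomPlanarGeometry.CurveClass ℂ)
      (fun (_ : ℝ) (x : Literature.Probability.RandomPlanarGeometry.CurveClass ℂ) => x) ν := by
    haveI : ∀ δ, IsProbabilityMeasure (ν δ) := hνprob
    refine Literature.Probability.RandomPlanarGeometry.convergesInLawToSLE_of_isTightAlongMesh'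
      (Filter.Eventually.of_forall fun δ => aemeasurable_id') ?_ ?_
    · -- tightness (h₆) transfers to the surrogate along the germ at `0⁺`
      intro ε hε
      obtain ⟨K, hK, hb⟩ := h₆ D a b hab ε hε
      refine ⟨K, hK, ?_⟩
      filter_upwards [hb, hev] with δ hδ hδ'
      have hpre : (fun x : Literature.Probability.RandomPlanarGeometry.CurveClass ℂ => x) ⁻¹' Kᶜ = Kᶜ :=
        rfl
      rw [hpre, hδ', Measure.map_apply_of_aemeasurable
        (Literature.Probability.RandomPlanarGeometry.SAW.aemeasurable_curve D.carrier δ (a δ) (b δ))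
        hK.isClosed.isOpen_compl.measurableSet]
      exact hδ
    · -- subsequential limit laws of the surrogate are subsequential limit laws of the SAW curve,
      -- identified by h₅
      rintro μ hμ ⟨s, hs, hlim⟩
      refine h₅ D a b hab s μ hs hμ fun f => ?_
      refine (hlim f).congr' ?_
      filter_upwards [hs.eventually hev] with n hn
      beta_reduce
      rw [hn, integral_map
        (Literature.Probability.RandomPlanarGeometry.SAW.aemeasurable_curve D.carrier (s n) (a (s n))
          (b (s n))) f.continuous.aestronglyMeasurable]
  -- (4) transfer the conclusion back to the SAW laws along the germ at `0⁺`
  obtain ⟨Γ, hΓ, -, hlaw⟩ := key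
  refine ⟨Γ, hΓ, Filter.Eventually.of_forall fun δ =>
    Literature.Probability.RandomPlanarGeometry.SAW.aemeasurable_curve D.carrier δ (a δ) (b δ),
    fun f => ?_⟩
  refine (hlaw f).congr' ?_
  filter_upwards [hev] with δ hδ
  beta_reduce
  rw [hδ, integral_map
    (Literature.Probability.RandomPlanarGeometry.SAW.aemeasurable_curve D.carrier δ (a δ) (b δ))
    f.continuous.aestronglyMeasurable]

end Summit.CriticalPhenomena.SAWScalingLimit.Theses.SAWTwistedSelfEnergy
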